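import Literature.Analysis.Complex.MellinBarnesShift
import Literature.Analysis.SpecialFunctions.GammaProductBounds
import Mathlib.Analysis.SpecialFunctions.Gamma.Deligne
import Mathlib.Analysis.MeanInequalities
import HarnessLib

/-!
# Booker 2003: growth in vertical strips of an entire `L`-function with the `GL(2)` functional
# equation (the Phragmén–Lindelöf input of the contour shifts) — proofs only

A. R. Booker, *Poles of Artin L-functions and the strong Artin conjecture*, Ann. of Math. 158
(2003), 1089–1098.  The functional equation (1), p. 1089, is
`γ(s) L(s, ρ) = ε N^{1/2−s} γ(1−s) L(1−s, ρ̄)` with, for two-dimensional `ρ` (p. 1090),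
`γ(s) = π^{-s} Γ((s+a)/2)²` (`a = 0, 1`) if `ρ` is even and `γ(s) = (2π)^{-s} Γ(s)` if `ρ` is
odd; both are `π^{-s} Γ((s+a₁)/2) Γ((s+a₂)/2)` up to a constant (`a₁ = a₂ = a`, resp. `a₁ = 0`,
`a₂ = 1` by Legendre's duplication formula), the form used here.  Twice in the proof of the
Theorem a contour is moved across a vertical strip with only the information that the
`L`-function is ENTIRE there and "the ratio of entire functions of order 1 (as given by Brauer)":
p. 1090, "it follows from … and the Phragmén–Lindelöf principle that (2) may be expressed as the
difference of two contour integrals along vertical lines", and p. 1096, "since `f₀(s)` is entire,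
by shifting the contour to the left, using Phragmén–Lindelöf to control `f₀(s)` in the critical
strip …".  This file proves the growth statement behind these words, for an abstract pair
`(L, L̃)` of entire functions (no Galois representations, no definitions, no named facts — D-0026):

* `norm_Gamma_half_one_sub_add_eq` — on `Re s = −1/2 − j` (`j : ℕ`, `Im s ≠ 0`) the
  `Γ`-quotient of the functional equation is an exact polynomial:
  `‖Γ((1 − s + a)/2)‖ = ‖Γ((s + a)/2)‖ ∏_{k ≤ j} ‖(s + a)/2 + k‖` (`1 − s = s̄ + 2j + 2`);
* `norm_eq_of_functionalEquation_of_re_eq` — hence the EXACT modulus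
  `‖L(s)‖ = ‖ε‖ N^{1+j} π^{−2−2j} ∏∏ ‖(s+aᵢ)/2 + k‖ · ‖L̃(1 − s)‖` on those lines;
* `norm_le_of_functionalEquation_of_re_eq` — with `‖L̃‖ ≤ M` on `Re ≥ 3/2`:
  `‖L(s)‖ ≤ K_j (1 + ‖s‖)^{2j+2}` on the whole line `Re s = −1/2 − j` (real point by continuity),
  `K_j = ‖ε‖ N^{1+j} π^{−2−2j} ((a₁+2j+1)(a₂+2j+1))^{j+1} M`;
* `exists_norm_le_mul_pow_of_mem_strip` — **the strip bound**: if moreover `L` is bounded on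
  `Re s ≥ 3/2` and of finite order `‖L(s)‖ ≤ C e^{‖s‖^c}` in the plane, then
  `‖L(s)‖ ≤ C_j (1 + ‖s‖)^{2j+2}` for `−1/2 − j ≤ Re s ≤ 3/2` — Rademacher's Phragmén–Lindelöf
  theorem in the packaged form `Literature.Analysis.Complex.norm_le_of_edge_bounds`
  (`MellinBarnesShift`), with `Literature.Analysis.Complex.exists_exp_norm_rpow_le`.

The finite-order hypothesis is supplied, for an entire quotient of entire functions of finite
order, by `Literature.Analysis.Complex.exists_norm_le_exp_rpow_of_mul_eq`
(`Analysis/Complex/EntireQuotientOrder`).  Lines at half-integers suffice for all of Booker's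
shifts (he moves "just to the right of 1", to `3/2 + Δ`, and "to the left … taking into account
the poles of `Γ`"), which is why the exact recurrence is used instead of Stirling's formula
(available in `Analysis/SpecialFunctions/GammaStirlingVertical` when sharp exponents matter, as in
(18)).

## References

* A. R. Booker, Ann. of Math. (2) 158 (2003), 1089–1098: (1) p. 1089; p. 1090 ((2)–(3));
  p. 1095 (18); p. 1096 ((20) and the paragraph after it). [Booker2003]
* H. Rademacher, *On the Phragmén–Lindelöf theorem and some applications*, Math. Z. 72 (1959),
  Thm 2. [Rademacher1959]

## Mathlib / tree search

Tree: `Literature.Analysis.Complex.norm_le_of_edge_bounds`, `exists_exp_norm_rpow_le`,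
`rpow_mul_rpow_le_add` (`MellinBarnesShift`), `rademacher_phragmenLindelof_of_finiteOrder`
(`RademacherPhragmenLindelof`), `inv_Gamma_eq_prod_mul_inv_Gamma_add_nat` (`GammaProductBounds`),
the model `norm_dedekindZetaCont_eq_of_re_eq_neg_half` (`LFunctions/DedekindZetaEntireConvexity`,
same exact-modulus device for `ζ_K`). Mathlib: `Complex.Gamma_conj`, `Complex.Gamma_add_one`,
`Complex.norm_cpow_eq_rpow_re_of_pos`, `Complex.Gamma_ne_zero`.
-/

noncomputable section

open Complex Real Set Filter Topology Finset

namespace Literature.NumberTheory.Automorphic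

namespace Booker2003

/-! ### The archimedean factor `γ(s) = π^{-s} Γ((s + a₁)/2) Γ((s + a₂)/2)` -/

/-- `Γ(w + m) = Γ(w) ∏_{k<m} (w + k)` whenever `Im w ≠ 0` (no poles are met). [folklore] -/
theorem Gamma_add_nat_eq_mul_prod_of_im_ne_zero {w : ℂ} (hw : w.im ≠ 0) (m : ℕ) :
    Complex.Gamma (w + m) = Complex.Gamma w * ∏ k ∈ Finset.range m, (w + k) := by
  induction m with
  | zero => simp
  | succ m ih =>
    have hne : w + (m : ℂ) ≠ 0 := by
      intro h0; have := congrArg Complex.im h0; simp at this; exact hw this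
    rw [show w + ((m + 1 : ℕ) : ℂ) = w + (m : ℂ) + 1 by push_cast; ring,
      Complex.Gamma_add_one _ hne, ih, Finset.prod_range_succ]
    ring

/-- `‖Γ(conj w)‖ = ‖Γ(w)‖`. [folklore] -/
theorem norm_Gamma_conj (w : ℂ) : ‖Complex.Gamma (starRingEnd ℂ w)‖ = ‖Complex.Gamma w‖ := by
  rw [Complex.Gamma_conj, Complex.norm_conj]

/-- On the line `Re s = −1/2 − j`: `1 − s = conj s + (2j + 2)`, so that
`(1 − s + a)/2 = (conj s + a)/2 + (j + 1)`. [folklore] -/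
theorem one_sub_eq_conj_add {s : ℂ} {j : ℕ} (hs : s.re = -1 / 2 - j) (a : ℕ) :
    (1 - s + a) / 2 = (starRingEnd ℂ s + a) / 2 + ((j + 1 : ℕ) : ℂ) := by
  apply Complex.ext
  · simp [hs]; ring
  · simp

/-- **Exact modulus of the `Γ`-quotient on the lines `Re s = −1/2 − j`.** For `a : ℕ`, `j : ℕ`
and `s` with `Re s = −1/2 − j`, `Im s ≠ 0`:
`‖Γ((1 − s + a)/2)‖ = ‖Γ((s + a)/2)‖ · ∏_{k ≤ j} ‖(s + a)/2 + k‖`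
(`1 − s = s̄ + 2j + 2`, the recurrence and `|Γ(w̄)| = |Γ(w)|`). [folklore] -/
theorem norm_Gamma_half_one_sub_add_eq {s : ℂ} {j : ℕ} (hs : s.re = -1 / 2 - j) (ht : s.im ≠ 0)
    (a : ℕ) :
    ‖Complex.Gamma ((1 - s + a) / 2)‖ =
      ‖Complex.Gamma ((s + a) / 2)‖ * ∏ k ∈ Finset.range (j + 1), ‖(s + a) / 2 + k‖ := by
  set w : ℂ := (starRingEnd ℂ s + a) / 2 with hw
  have hwim : w.im ≠ 0 := by
    simp only [hw, Complex.div_ofNat_im, Complex.add_im, Complex.conj_im, Complex.natCast_im,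
      add_zero]
    intro h; apply ht; linarith
  have hconj : w = starRingEnd ℂ ((s + a) / 2) := by
    rw [hw, map_div₀, map_add, Complex.conj_natCast, map_ofNat]
  rw [one_sub_eq_conj_add hs a, ← hw, Gamma_add_nat_eq_mul_prod_of_im_ne_zero hwim, norm_mul,
    norm_prod, hconj, norm_Gamma_conj]
  congr 1
  refine Finset.prod_congr rfl fun k _ ↦ ?_
  rw [← Complex.norm_conj (starRingEnd ℂ ((s + ↑a) / 2) + ↑k), map_add, Complex.conj_conj,
    Complex.conj_natCast]


/-- `‖(s + a)/2 + k‖ ≤ (a + 2j + 1)(1 + ‖s‖)` for `k ≤ j`. [folklore] -/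
theorem norm_half_add_nat_le {s : ℂ} {a j k : ℕ} (hk : k ≤ j) :
    ‖(s + a) / 2 + k‖ ≤ (a + 2 * j + 1) * (1 + ‖s‖) := by
  have h1 : ‖(s + a) / 2 + k‖ ≤ ‖s‖ / 2 + (a + 2 * k) / 2 := by
    have e : (s + a) / 2 + k = s / 2 + ((a + 2 * k : ℝ) : ℂ) / 2 := by push_cast; ring
    rw [e]
    refine (norm_add_le _ _).trans ?_
    rw [norm_div, norm_div, Complex.norm_real, Real.norm_eq_abs,
      abs_of_nonneg (by positivity : (0 : ℝ) ≤ a + 2 * k)]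
    norm_num
  have hkj : (k : ℝ) ≤ j := by exact_mod_cast hk
  have hs0 : 0 ≤ ‖s‖ := norm_nonneg s
  nlinarith

/-- `∏_{k ≤ j} ‖(s + a)/2 + k‖ ≤ ((a + 2j + 1)(1 + ‖s‖))^{j+1}`. [folklore] -/
theorem prod_norm_half_add_nat_le (s : ℂ) (a j : ℕ) :
    ∏ k ∈ Finset.range (j + 1), ‖(s + a) / 2 + k‖ ≤ ((a + 2 * j + 1) * (1 + ‖s‖)) ^ (j + 1) := by
  calc ∏ k ∈ Finset.range (j + 1), ‖(s + a) / 2 + k‖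
      ≤ ∏ _k ∈ Finset.range (j + 1), ((a + 2 * j + 1) * (1 + ‖s‖)) :=
        Finset.prod_le_prod (fun k _ ↦ norm_nonneg _) fun k hk ↦
          norm_half_add_nat_le (Nat.lt_succ_iff.mp (Finset.mem_range.mp hk))
    _ = ((a + 2 * j + 1) * (1 + ‖s‖)) ^ (j + 1) := by
        rw [Finset.prod_const, Finset.card_range]

/-! ### The functional equation: exact modulus and polynomial bound on `Re s = −1/2 − j` -/

section FE

variable {L Ld : ℂ → ℂ} {a₁ a₂ : ℕ} {N : ℝ} {ε : ℂ}

/-- **Exact modulus on the lines `Re s = −1/2 − j`.** Let `L`, `L̃` satisfy Booker's functional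
equation (1) (Ann. of Math. 158, p. 1089), `γ(s) L(s) = ε N^{1/2−s} γ(1−s) L̃(1−s)` with the
`GL(2)` archimedean factor `γ(s) = π^{-s} Γ((s+a₁)/2) Γ((s+a₂)/2)` (`a₁ = a₂ = a ∈ {0, 1}` for even
`ρ`; `a₁ = 0`, `a₂ = 1` for odd `ρ`, where `(2π)^{-s}Γ(s) = π^{-s}Γ(s/2)Γ((s+1)/2)/(2√π)`), at
every `s` off the real axis. Then for `Re s = −1/2 − j` (`j : ℕ`), `Im s ≠ 0`:
`‖L(s)‖ = ‖ε‖ N^{1+j} π^{−2−2j} ∏_{k≤j} ‖(s+a₁)/2 + k‖ ∏_{k≤j} ‖(s+a₂)/2 + k‖ · ‖L̃(1 − s)‖`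
(there `1 − s = s̄ + 2j + 2` and the `Γ`-quotient is an exact polynomial). [folklore] -/
theorem norm_eq_of_functionalEquation_of_re_eq
    (hFE : ∀ s : ℂ, s.im ≠ 0 →
      (π : ℂ) ^ (-s) * Complex.Gamma ((s + a₁) / 2) * Complex.Gamma ((s + a₂) / 2) * L s =
        ε * (N : ℂ) ^ (1 / 2 - s) *
          ((π : ℂ) ^ (-(1 - s)) * Complex.Gamma ((1 - s + a₁) / 2) *
            Complex.Gamma ((1 - s + a₂) / 2)) * Ld (1 - s))
    (hN : 0 < N) {j : ℕ} {s : ℂ} (hs : s.re = -1 / 2 - j) (ht : s.im ≠ 0) :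
    ‖L s‖ = ‖ε‖ * N ^ (1 + j : ℝ) * π ^ (-(2 + 2 * j : ℝ)) *
      ((∏ k ∈ Finset.range (j + 1), ‖(s + a₁) / 2 + k‖) *
        ∏ k ∈ Finset.range (j + 1), ‖(s + a₂) / 2 + k‖) * ‖Ld (1 - s)‖ := by
  have h := congrArg norm (hFE s ht)
  simp only [norm_mul] at h
  -- the norms of the elementary factors
  have hπ1 : ‖(π : ℂ) ^ (-s)‖ = π ^ (1 / 2 + j : ℝ) := by
    rw [Complex.norm_cpow_eq_rpow_re_of_pos Real.pi_pos]; congr 1; simp [hs]; ring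
  have hπ2 : ‖(π : ℂ) ^ (-(1 - s))‖ = π ^ (-(3 / 2 + j) : ℝ) := by
    rw [Complex.norm_cpow_eq_rpow_re_of_pos Real.pi_pos]; congr 1; simp [hs]; ring
  have hNn : ‖(N : ℂ) ^ (1 / 2 - s)‖ = N ^ (1 + j : ℝ) := by
    rw [Complex.norm_cpow_eq_rpow_re_of_pos hN]; congr 1; simp [hs]; ring
  -- the Γ-factors
  have hG1 := norm_Gamma_half_one_sub_add_eq hs ht a₁
  have hG2 := norm_Gamma_half_one_sub_add_eq hs ht a₂
  have hne : ∀ a : ℕ, Complex.Gamma ((s + a) / 2) ≠ 0 := fun a ↦ by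
    refine Complex.Gamma_ne_zero fun m hm ↦ ?_
    have := congrArg Complex.im hm
    simp at this
    exact ht this
  have hpos1 : 0 < ‖Complex.Gamma ((s + a₁) / 2)‖ := norm_pos_iff.mpr (hne a₁)
  have hpos2 : 0 < ‖Complex.Gamma ((s + a₂) / 2)‖ := norm_pos_iff.mpr (hne a₂)
  rw [hπ1, hπ2, hNn, hG1, hG2] at h
  set G1 := ‖Complex.Gamma ((s + a₁) / 2)‖
  set G2 := ‖Complex.Gamma ((s + a₂) / 2)‖
  set P1 := ∏ k ∈ Finset.range (j + 1), ‖(s + a₁) / 2 + k‖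
  set P2 := ∏ k ∈ Finset.range (j + 1), ‖(s + a₂) / 2 + k‖
  have hππ : (π : ℝ) ^ (1 / 2 + j : ℝ) * π ^ (-(2 + 2 * j : ℝ)) = π ^ (-(3 / 2 + j) : ℝ) := by
    rw [← Real.rpow_add Real.pi_pos]; congr 1; ring
  have hπpos : 0 < (π : ℝ) ^ (1 / 2 + j : ℝ) := Real.rpow_pos_of_pos Real.pi_pos _
  -- divide the identity by `π^{1/2+j} G1 G2 > 0`
  have hkey : π ^ (1 / 2 + j : ℝ) * G1 * G2 * ‖L s‖ =
      π ^ (1 / 2 + j : ℝ) * G1 * G2 * (‖ε‖ * N ^ (1 + j : ℝ) * π ^ (-(2 + 2 * j : ℝ)) *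
        (P1 * P2) * ‖Ld (1 - s)‖) := by
    rw [h]
    have : ‖ε‖ * N ^ (1 + j : ℝ) * (π ^ (-(3 / 2 + j) : ℝ) * (G1 * P1) * (G2 * P2)) * ‖Ld (1 - s)‖ =
        ‖ε‖ * N ^ (1 + j : ℝ) * ((π : ℝ) ^ (1 / 2 + j : ℝ) * π ^ (-(2 + 2 * j : ℝ)) * (G1 * P1) *
          (G2 * P2)) * ‖Ld (1 - s)‖ := by rw [hππ]
    rw [this]; ring
  exact mul_left_cancel₀ (by positivity : π ^ (1 / 2 + j : ℝ) * G1 * G2 ≠ 0) hkey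

/-- **Polynomial bound on the lines `Re s = −1/2 − j` from the functional equation.** Under the
functional equation of `norm_eq_of_functionalEquation_of_re_eq` and `‖L̃(w)‖ ≤ M` for
`Re w ≥ 3/2`, for every `s` with `Re s = −1/2 − j` (the real point included, by continuity of the
entire `L`):
`‖L(s)‖ ≤ ‖ε‖ N^{1+j} π^{−2−2j} ((a₁+2j+1)(a₂+2j+1))^{j+1} M · (1 + ‖s‖)^{2j+2}`. [folklore] -/
theorem norm_le_of_functionalEquation_of_re_eq (hL : Differentiable ℂ L)
    (hFE : ∀ s : ℂ, s.im ≠ 0 →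
      (π : ℂ) ^ (-s) * Complex.Gamma ((s + a₁) / 2) * Complex.Gamma ((s + a₂) / 2) * L s =
        ε * (N : ℂ) ^ (1 / 2 - s) *
          ((π : ℂ) ^ (-(1 - s)) * Complex.Gamma ((1 - s + a₁) / 2) *
            Complex.Gamma ((1 - s + a₂) / 2)) * Ld (1 - s))
    (hN : 0 < N) {M : ℝ} (hLd : ∀ w : ℂ, 3 / 2 ≤ w.re → ‖Ld w‖ ≤ M)
    {j : ℕ} {s : ℂ} (hs : s.re = -1 / 2 - j) :
    ‖L s‖ ≤ ‖ε‖ * N ^ (1 + j : ℝ) * π ^ (-(2 + 2 * j : ℝ)) *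
      (((a₁ + 2 * j + 1) * (a₂ + 2 * j + 1) : ℝ) ^ (j + 1) * M) * (1 + ‖s‖) ^ (2 * j + 2) := by
  have hM0 : 0 ≤ M := (norm_nonneg _).trans (hLd 2 (by norm_num))
  -- the bound off the real axis
  have hoff : ∀ z : ℂ, z.re = -1 / 2 - j → z.im ≠ 0 →
      ‖L z‖ ≤ ‖ε‖ * N ^ (1 + j : ℝ) * π ^ (-(2 + 2 * j : ℝ)) *
        (((a₁ + 2 * j + 1) * (a₂ + 2 * j + 1) : ℝ) ^ (j + 1) * M) * (1 + ‖z‖) ^ (2 * j + 2) := by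
    intro z hz hzt
    rw [norm_eq_of_functionalEquation_of_re_eq hFE hN hz hzt]
    have hP1 := prod_norm_half_add_nat_le z a₁ j
    have hP2 := prod_norm_half_add_nat_le z a₂ j
    have hLd' : ‖Ld (1 - z)‖ ≤ M := hLd _ (by
      simp only [Complex.sub_re, Complex.one_re, hz]
      have : (0 : ℝ) ≤ j := Nat.cast_nonneg j
      linarith)
    have hP10 : 0 ≤ ∏ k ∈ Finset.range (j + 1), ‖(z + a₁) / 2 + k‖ :=
      Finset.prod_nonneg fun _ _ ↦ norm_nonneg _
    have hP20 : 0 ≤ ∏ k ∈ Finset.range (j + 1), ‖(z + a₂) / 2 + k‖ :=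
      Finset.prod_nonneg fun _ _ ↦ norm_nonneg _
    have hPP : (∏ k ∈ Finset.range (j + 1), ‖(z + a₁) / 2 + k‖) *
        (∏ k ∈ Finset.range (j + 1), ‖(z + a₂) / 2 + k‖) * ‖Ld (1 - z)‖ ≤
        ((a₁ + 2 * j + 1) * (a₂ + 2 * j + 1) : ℝ) ^ (j + 1) * M * (1 + ‖z‖) ^ (2 * j + 2) := by
      set A₁ : ℝ := (a₁ : ℝ) + 2 * j + 1 with hA₁
      set A₂ : ℝ := (a₂ : ℝ) + 2 * j + 1 with hA₂
      set X : ℝ := 1 + ‖z‖ with hX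
      have hX0 : 0 ≤ X := by positivity
      calc _ ≤ (A₁ * X) ^ (j + 1) * ((A₂ * X) ^ (j + 1)) * M :=
            mul_le_mul (mul_le_mul hP1 hP2 hP20 (by positivity)) hLd' (norm_nonneg _) (by positivity)
        _ = (A₁ * A₂) ^ (j + 1) * M * X ^ (2 * j + 2) := by ring
    have hc0 : 0 ≤ ‖ε‖ * N ^ (1 + j : ℝ) * π ^ (-(2 + 2 * j : ℝ)) := by positivity
    calc ‖ε‖ * N ^ (1 + j : ℝ) * π ^ (-(2 + 2 * j : ℝ)) *
          ((∏ k ∈ Finset.range (j + 1), ‖(z + a₁) / 2 + k‖) *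
            ∏ k ∈ Finset.range (j + 1), ‖(z + a₂) / 2 + k‖) * ‖Ld (1 - z)‖
        = ‖ε‖ * N ^ (1 + j : ℝ) * π ^ (-(2 + 2 * j : ℝ)) *
          ((∏ k ∈ Finset.range (j + 1), ‖(z + a₁) / 2 + k‖) *
            (∏ k ∈ Finset.range (j + 1), ‖(z + a₂) / 2 + k‖) * ‖Ld (1 - z)‖) := by ring
      _ ≤ ‖ε‖ * N ^ (1 + j : ℝ) * π ^ (-(2 + 2 * j : ℝ)) *
          (((a₁ + 2 * j + 1) * (a₂ + 2 * j + 1) : ℝ) ^ (j + 1) * M * (1 + ‖z‖) ^ (2 * j + 2)) :=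
          mul_le_mul_of_nonneg_left hPP hc0
      _ = _ := by ring
  -- the real point by continuity
  by_cases ht : s.im ≠ 0
  · exact hoff s hs ht
  · push Not at ht
    set K : ℝ := ‖ε‖ * N ^ (1 + j : ℝ) * π ^ (-(2 + 2 * j : ℝ)) *
      (((a₁ + 2 * j + 1) * (a₂ + 2 * j + 1) : ℝ) ^ (j + 1) * M) with hK
    -- `g t = ‖L (s + t i)‖ − K (1 + ‖s + t i‖)^(2j+2)` is continuous and `≤ 0` for `t ≠ 0`
    set g : ℝ → ℝ := fun t ↦ ‖L (s + t * I)‖ - K * (1 + ‖s + t * I‖) ^ (2 * j + 2) with hg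
    have hgc : Continuous g := by
      have h1 : Continuous fun t : ℝ ↦ s + t * I := by fun_prop
      exact (continuous_norm.comp (hL.continuous.comp h1)).sub
        (continuous_const.mul ((continuous_const.add (continuous_norm.comp h1)).pow _))
    have hneg : ∀ t : ℝ, t ≠ 0 → g t ≤ 0 := by
      intro t ht0
      have h := hoff (s + t * I) (by simp [hs]) (by simp [ht, ht0])
      simp only [hg]; linarith
    have hlim : Tendsto g (𝓝[≠] 0) (𝓝 (g 0)) :=
      (hgc.tendsto 0).mono_left nhdsWithin_le_nhds
    have h0 : g 0 ≤ 0 := le_of_tendsto hlim (eventually_nhdsWithin_of_forall hneg)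
    have : s + (0 : ℝ) * I = s := by simp
    simp only [hg, this] at h0
    rw [hK]; linarith

end FE


/-! ### Inside the strip: Phragmén–Lindelöf (Rademacher) -/

section Strip

variable {L Ld : ℂ → ℂ} {a₁ a₂ : ℕ} {N : ℝ} {ε : ℂ}

open Literature.Analysis.Complex in
/-- **Polynomial growth in vertical strips (Booker 2003, the Phragmén–Lindelöf step).** Let `L`
be ENTIRE and of finite order (`‖L(s)‖ ≤ C e^{‖s‖^c}` — for Booker's `L(s, ρ)` under Artin's
conjecture this is "the ratio of entire functions of order 1 (as given by Brauer)", p. 1090, made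
effective by `Literature.Analysis.Complex.exists_norm_le_exp_rpow_of_mul_eq`), bounded together
with `L̃` on `Re s ≥ 3/2` (absolute convergence), and let `L, L̃` satisfy the functional equation
(1) with `γ(s) = π^{-s}Γ((s+a₁)/2)Γ((s+a₂)/2)` off the real axis. Then for every `j : ℕ` there is
`C_j` with `‖L(s)‖ ≤ C_j (1 + ‖s‖)^{2j+2}` throughout `−1/2 − j ≤ Re s ≤ 3/2` — the growth that
makes the horizontal sides of Booker's contour shifts ((2) = (3), (18)–(20)) negligible.
Rademacher's theorem (`norm_le_of_edge_bounds`) between the exact-modulus line `Re s = −1/2 − j`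
(`norm_le_of_functionalEquation_of_re_eq`) and `Re s = 3/2`.
[cite: Booker2003, p. 1090 (passage from (2) to (3)) and p. 1096] -/
theorem exists_norm_le_mul_pow_of_mem_strip (hL : Differentiable ℂ L)
    (hFE : ∀ s : ℂ, s.im ≠ 0 →
      (π : ℂ) ^ (-s) * Complex.Gamma ((s + a₁) / 2) * Complex.Gamma ((s + a₂) / 2) * L s =
        ε * (N : ℂ) ^ (1 / 2 - s) *
          ((π : ℂ) ^ (-(1 - s)) * Complex.Gamma ((1 - s + a₁) / 2) *
            Complex.Gamma ((1 - s + a₂) / 2)) * Ld (1 - s))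
    (hN : 0 < N) {M : ℝ} (hLd : ∀ w : ℂ, 3 / 2 ≤ w.re → ‖Ld w‖ ≤ M)
    (hLb : ∀ w : ℂ, 3 / 2 ≤ w.re → ‖L w‖ ≤ M)
    (hFO : ∃ C c : ℝ, 0 < c ∧ ∀ s : ℂ, ‖L s‖ ≤ C * Real.exp (‖s‖ ^ c)) (j : ℕ) :
    ∃ C : ℝ, 0 ≤ C ∧ ∀ s : ℂ, -1 / 2 - j ≤ s.re → s.re ≤ 3 / 2 →
      ‖L s‖ ≤ C * (1 + ‖s‖) ^ (2 * j + 2) := by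
  obtain ⟨C₀, c, hc, hC₀⟩ := hFO
  -- data of the strip
  set a : ℝ := -1 / 2 - j with ha
  set b : ℝ := 3 / 2 with hb
  set Q : ℝ := j + 1 with hQ
  have hj0 : (0 : ℝ) ≤ j := Nat.cast_nonneg j
  have hab : a < b := by rw [ha, hb]; linarith
  have hQa : 0 < Q + a := by rw [hQ, ha]; linarith
  -- the edge constant on `Re s = a`
  set K : ℝ := ‖ε‖ * N ^ (1 + j : ℝ) * π ^ (-(2 + 2 * j : ℝ)) *
    (((a₁ + 2 * j + 1) * (a₂ + 2 * j + 1) : ℝ) ^ (j + 1) * M) with hK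
  have hM0 : 0 ≤ M := (norm_nonneg _).trans (hLd 2 (by norm_num))
  have hK0 : 0 ≤ K := by positivity
  set α : ℝ := ((2 * j + 2 : ℕ) : ℝ) with hα
  have hα0 : 0 ≤ α := by positivity
  set A : ℝ := K * (2 * Q + 3) ^ (2 * j + 2) + 1 with hA
  have hA0 : 0 < A := by positivity
  set B : ℝ := max M 1 with hB
  have hB0 : 0 < B := lt_max_of_lt_right one_pos
  -- edge `a`
  have hedge_a : ∀ z : ℂ, z.re = a → ‖L z‖ ≤ A * ‖(Q : ℂ) + z‖ ^ α := by
    intro z hz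
    have h1 := norm_le_of_functionalEquation_of_re_eq hL hFE hN hLd (j := j) (s := z) (by rw [hz, ha])
    have hQz : 1 / 2 ≤ ‖(Q : ℂ) + z‖ := by
      have : ((Q : ℂ) + z).re = Q + z.re := by simp
      have h := Complex.re_le_norm ((Q : ℂ) + z)
      rw [this, hz] at h; linarith
    have hcmp : 1 + ‖z‖ ≤ (2 * Q + 3) * ‖(Q : ℂ) + z‖ := by
      have : ‖z‖ ≤ ‖(Q : ℂ) + z‖ + Q := by
        calc ‖z‖ = ‖((Q : ℂ) + z) - Q‖ := by ring_nf
          _ ≤ ‖(Q : ℂ) + z‖ + ‖(Q : ℂ)‖ := norm_sub_le _ _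
          _ = ‖(Q : ℂ) + z‖ + Q := by
              rw [Complex.norm_real, Real.norm_eq_abs, abs_of_pos (by positivity)]
      nlinarith
    have hpow : (1 + ‖z‖) ^ (2 * j + 2) ≤ (2 * Q + 3) ^ (2 * j + 2) * ‖(Q : ℂ) + z‖ ^ α := by
      rw [hα, Real.rpow_natCast, ← mul_pow]
      exact pow_le_pow_left₀ (by positivity) hcmp _
    calc ‖L z‖ ≤ K * (1 + ‖z‖) ^ (2 * j + 2) := by rw [hK]; exact h1
      _ ≤ K * ((2 * Q + 3) ^ (2 * j + 2) * ‖(Q : ℂ) + z‖ ^ α) := mul_le_mul_of_nonneg_left hpow hK0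
      _ ≤ A * ‖(Q : ℂ) + z‖ ^ α := by
          rw [hA]; nlinarith [Real.rpow_nonneg (norm_nonneg ((Q : ℂ) + z)) α]
  -- edge `b`
  have hedge_b : ∀ z : ℂ, z.re = b → ‖L z‖ ≤ B := fun z hz ↦
    (hLb z (by rw [hz])).trans (le_max_left _ _)
  -- finite order in the strip
  obtain ⟨K₁, hK₁, hK₁b⟩ := exists_exp_norm_rpow_le (j + 2) c (by positivity) hc
  have hgr : ∀ z : ℂ, a < z.re → z.re < b → ‖L z‖ ≤ max C₀ 0 * K₁ * Real.exp (|z.im| ^ (c + 1)) := by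
    intro z hza hzb
    have hre : |z.re| ≤ j + 2 := by
      rw [abs_le]; rw [ha] at hza; rw [hb] at hzb; constructor <;> linarith
    calc ‖L z‖ ≤ C₀ * Real.exp (‖z‖ ^ c) := hC₀ z
      _ ≤ max C₀ 0 * Real.exp (‖z‖ ^ c) := by gcongr; exact le_max_left _ _
      _ ≤ max C₀ 0 * (K₁ * Real.exp (|z.im| ^ (c + 1))) :=
          mul_le_mul_of_nonneg_left (hK₁b z hre) (le_max_right _ _)
      _ = _ := by ring
  -- Rademacher
  refine ⟨A * (Q + 1) ^ (2 * j + 2) + B, by positivity, fun s hsa hsb ↦ ?_⟩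
  have hPL := norm_le_of_edge_bounds hL hab hQa hA0 hB0 hα0 (by linarith : 0 < c + 1) hgr hedge_a
    hedge_b (z := s) (by rw [ha]; exact hsa) (by rw [hb]; exact hsb)
  have hQs : ‖(Q : ℂ) + s‖ ≤ (Q + 1) * (1 + ‖s‖) := by
    calc ‖(Q : ℂ) + s‖ ≤ ‖(Q : ℂ)‖ + ‖s‖ := norm_add_le _ _
      _ = Q + ‖s‖ := by rw [Complex.norm_real, Real.norm_eq_abs, abs_of_pos (by positivity)]
      _ ≤ (Q + 1) * (1 + ‖s‖) := by nlinarith [norm_nonneg s]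
  have hpow : ‖(Q : ℂ) + s‖ ^ α ≤ (Q + 1) ^ (2 * j + 2) * (1 + ‖s‖) ^ (2 * j + 2) := by
    rw [hα, Real.rpow_natCast, ← mul_pow]
    exact pow_le_pow_left₀ (norm_nonneg _) hQs _
  have hone : (1 : ℝ) ≤ (1 + ‖s‖) ^ (2 * j + 2) := one_le_pow₀ (by linarith [norm_nonneg s])
  calc ‖L s‖ ≤ A * ‖(Q : ℂ) + s‖ ^ α + B := hPL
    _ ≤ A * ((Q + 1) ^ (2 * j + 2) * (1 + ‖s‖) ^ (2 * j + 2)) + B * (1 + ‖s‖) ^ (2 * j + 2) := by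
        have h1 := mul_le_mul_of_nonneg_left hpow hA0.le
        have h2 : B ≤ B * (1 + ‖s‖) ^ (2 * j + 2) := le_mul_of_one_le_right hB0.le hone
        linarith
    _ = (A * (Q + 1) ^ (2 * j + 2) + B) * (1 + ‖s‖) ^ (2 * j + 2) := by ring

end Strip

end Booker2003

end Literature.NumberTheory.Automorphic

end
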